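import Summits.QuantumFields.YangMills.Theorems.BalabanUVNodesPortS1JacPiecesDefs

/-!
# NODE O port PT-A — ROW (e) OF `stub_LZjac`, THE UNIVERSAL-COVER BRIDGE, PART 1: the (0.4) block averaging on `ℤ^d` IS the torus averaging read through the level covers
# `π_j : ℤ^d → T^{(j)}` — `avgMhZ L (𝐕 ∘ π_j) = avgMh 𝐕 ∘ π_{j+1}`, `iterMhZ L k (𝐔 ∘ π_0) = iterMh k 𝐔 ∘ π_k`, for EVERY configuration (global identities) — and the INTEGER
# LOCALITY of the (0.4) average and of the derivative block (they read the window `B(ĉ₋) ∪ B(ĉ₊)` only)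

Cell `ym-nodeO-ideate`, porter seat `ymgap-nodeO-port-PTA-1` (gen 6); `--supports stmt-QuantumFields-27930` (helper); objects: ✓ `…PortS1JacPiecesDefs` (p814190).  [I] = [Balaban1987RG1].
WHY.  [I] (1.21) p.264 binds the localized pieces of a domain across volumes («T^{(j+1)} ↗ Z^d … exists by the localized representation (1.7)»): the piece is ONE formula on the universal
cover.  For the δ-Jacobian bracket the formula is the (0.4) computation done on `ℤ^d` (✓ `…JacPiecesDefs` §3–§6); this file proves that it IS the torus computation pulled back — with no
window hypothesis, because `π_j` is a homomorphism intertwining `± e_μ` (`Node00.coverAt_add_e ∕ sub_e`), block centres (`Node00.emb_coverAt`) and blocks — and that the integer average and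
block at `ĉ` read the configuration on the window bonds of `ĉ` only (every prefix of a (0.4) contour stays in the box `[−h, h]^{d−1} × [−h, L + h]`, `BlockAveraging.netDisp_take_loopWord`).
* §1 `walk_coverAt` (walks), `holMh_map_coverStepAt ∕ holMh_walk_coverAt` (walk products).
* §2 `coverBondAt_centralBondZ` (central bond), `loopMhZ ∕ axialMhZ ∕ corrMhZ ∕ avgMhZ_comp_coverBondAt` ★★, `iterMhZ_comp_coverBondAt` ★★.
* §3 `endpoints_of_mem_walkZ`, `embZ_add_mem_winSitesZ`, `mem_winBondsZ_of_mem_walkZ_loopWord ∕ _replicate`, ★ `avgMhZ_congr_of_eqOn_winBondsZ` (integer two-block locality), `avgMhZW_restrictZ`,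
  `centralBondZ_mem_winBondsZ`, ★ `jacBlockZ_congr_of_eqOn_winBondsZ`, `jacFactorZ_congr_of_eqOn_winBondsZ`.
Part 2 (`…JacCoverDeriv`): the derivative block and `J_T(π_{k+1} ĉ, 𝐔) = J_ℤ(ĉ, 𝐔 ∘ π_0)`.

HONEST FRAMING.  Lattice ∕ walk bookkeeping over the tree's own (0.4) model; NOTHING of Bałaban's estimates asserted, ported or discharged; `stub_LZjac` OPEN; 27930 OPEN · no claim; K0⁷∕K-Ax
OPEN; NODE O 0∕1; COUNT 8∕28 · K 1∕4 UNMOVED; finite `𝕋⁴_{L^K}` at fixed ε — NOT continuum ∕ OS ∕ Clay; **the Yang–Mills mass gap is NOT proved by any of this.**  No `sorry`, no `def`,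
no `instance`, no `notation`; standard axioms.
-/

noncomputable section

open scoped BigOperators Matrix.Norms.L2Operator Topology

namespace Summit.QuantumFields.YangMills.Theorems.BalabanUVNodesPortS1

open Summit.QuantumFields.YangMills.Theorems.K0RecordFormatNames
open Literature.MathematicalPhysics.QuantumFieldTheory.Balaban1983to89
open Literature.MathematicalPhysics.QuantumFieldTheory.Balaban1983to89.Node00
open Literature.MathematicalPhysics.QuantumFieldTheory.Balaban1983to89.T4Continuum (T4Family Letter LStep loopWord walk walkEnd netDisp netDisp_take_loopWord)
open Literature.MathematicalPhysics.QuantumFieldTheory.Balaban1983to89.BlockAveragingHaarAC (centralBond)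
open Literature.MathematicalPhysics.QuantumFieldTheory.Balaban1983to89.B15AveragingHolomorphic (avgMh iterMh stepMh holMh loopMh axialMh corrMh)
open Literature.MathematicalPhysics.QuantumFieldTheory.Balaban1983to89.ExpMeanLog (eml)
open Literature.MathematicalPhysics.QuantumFieldTheory.Balaban1983to89.B7Prop1Explicit (e e_apply disp disp_cons disp_nil disp_replicate Letter.vec_true Letter.vec_false)
open Literature.MathematicalPhysics.QuantumFieldTheory.Balaban1983to89.BlockAveragingZd (IdxZ offZ disp_eq_netDisp offZ_bounds)
open Literature.MathematicalPhysics.QuantumFieldTheory.Balaban1983to89.BlockAveraging (Idx off)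
open Literature.MathematicalPhysics.QuantumLattice (blockMap blockSites mem_blockSites_iff)
open _root_.Matrix

/-! ## §1  The cover on walks and walk products -/

section CoverWalks

variable {P : Params} {j : ℕ}

/-- Components of the covered bond. [cite: Balaban1987RG1, (1.21) p.264 (bookkeeping)] -/
@[simp] theorem coverBondAt_src (b : (Fin P.d → ℤ) × Fin P.d) : (coverBondAt P j b).src = coverAt P j b.1 := rfl

/-- Components of the covered bond. [cite: Balaban1987RG1, (1.21) p.264 (bookkeeping)] -/
@[simp] theorem coverBondAt_dir (b : (Fin P.d → ℤ) × Fin P.d) : (coverBondAt P j b).dir = b.2 := rfl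

/-- ★ **THE COVER INTERTWINES WALKS**: the torus walk spelled by `w` from `π_j x` is the image of the integer walk spelled by `w` from `x` (`π_j` intertwines `± e_μ`,
`Node00.coverAt_add_e ∕ coverAt_sub_e`). [cite: Balaban1987RG1, (0.3)–(0.4) pp.252–253, (1.21) p.264] -/
theorem walk_coverAt : ∀ (x : Fin P.d → ℤ) (w : List (Letter P.d)),
    walk (coverAt P j x) w = (walkZ x w).map (coverStepAt P j)
  | _, [] => rfl
  | x, (μ, true) :: w => by
    simp only [walk, walkZ, List.map_cons]
    rw [← coverAt_add_e, walk_coverAt (x + e μ) w]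
    rfl
  | x, (μ, false) :: w => by
    simp only [walk, walkZ, List.map_cons]
    rw [← coverAt_sub_e, walk_coverAt (x - e μ) w]
    rfl

/-- The holomorphic step matrix of a covered step is the integer step matrix of the pulled-back configuration. [cite: Balaban1987RG1, (0.4) p.253 (bookkeeping)] -/
theorem stepMh_coverStepAt (V : PBond P j → MatA 2) (s : ((Fin P.d → ℤ) × Fin P.d) × Bool) :
    stepMh V (coverStepAt P j s) = stepMhZ (fun b => V (coverBondAt P j b)) s := rfl

/-- ★ **WALK PRODUCTS UNDER THE COVER**: `holMh V (π_j γ) = holMhZ (V ∘ π_j) γ`. [cite: Balaban1987RG1, (0.4) p.253, (1.21) p.264] -/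
theorem holMh_map_coverStepAt (V : PBond P j → MatA 2) (γ : List (((Fin P.d → ℤ) × Fin P.d) × Bool)) :
    holMh V (γ.map (coverStepAt P j)) = holMhZ (fun b => V (coverBondAt P j b)) γ := by
  unfold holMh holMhZ
  rw [List.map_map]
  rfl

/-- Walk products of a pulled-back configuration along the walk spelled by a word. [cite: Balaban1987RG1, (0.4) p.253, (1.21) p.264] -/
theorem holMh_walk_coverAt (V : PBond P j → MatA 2) (x : Fin P.d → ℤ) (w : List (Letter P.d)) :
    holMh V (walk (coverAt P j x) w) = holMhZ (fun b => V (coverBondAt P j b)) (walkZ x w) := by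
  rw [walk_coverAt, holMh_map_coverStepAt]

end CoverWalks

/-! ## §2  The cover on block centres, the central bond, loops, segments, the (0.4) average and its iterate -/

section CoverAverages

variable {P : Params} {j : ℕ}

/-- **Block centres under the cover**: `emb (π_{j+1} y) = π_j (embZ L y)` (standing range; `Node00.emb_coverAt`). [cite: Balaban1987RG1, (0.1) p.252] -/
theorem emb_coverAt_eq_coverAt_embZ (hj : j + 1 ≤ P.m + P.K) (y : Fin P.d → ℤ) : emb (coverAt P (j + 1) y) = coverAt P j (embZ P.L y) :=
  emb_coverAt hj y

/-- The cover commutes with adding an integer to one coordinate. [cite: Balaban1987RG1, (0.1) p.251 (bookkeeping)] -/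
theorem coverAt_update_add (z : Fin P.d → ℤ) (μ : Fin P.d) (t : ℤ) :
    coverAt P j (Function.update z μ (z μ + t)) = Function.update (coverAt P j z) μ (coverAt P j z μ + (t : ZMod (P.sitesPerDir j))) := by
  funext ν
  by_cases h : ν = μ
  · subst h
    simp [coverAt_apply]
  · simp [coverAt_apply, h]

/-- ★ **THE CENTRAL BOND UNDER THE COVER**: `π_j (b₀(ĉ)) = b₀(π_{j+1} ĉ)` (standing range). [cite: Balaban1987RG1, p.267 («h(c)»; bookkeeping)] -/
theorem coverBondAt_centralBondZ (hj : j + 1 ≤ P.m + P.K) (ĉ : (Fin P.d → ℤ) × Fin P.d) :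
    coverBondAt P j (centralBondZ P.L ĉ) = centralBond (coverBondAt P (j + 1) ĉ) := by
  show (⟨coverAt P j (Function.update (embZ P.L ĉ.1) ĉ.2 (embZ P.L ĉ.1 ĉ.2 + (((P.L - 1) / 2 : ℕ) : ℤ))), ĉ.2⟩ : PBond P j) =
    ⟨Function.update (emb (coverAt P (j + 1) ĉ.1)) ĉ.2 (emb (coverAt P (j + 1) ĉ.1) ĉ.2 + (((P.L - 1) / 2 : ℕ) : ZMod (P.sitesPerDir j))), ĉ.2⟩
  rw [coverAt_update_add, emb_coverAt_eq_coverAt_embZ hj, Int.cast_natCast]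

/-- ★ **THE (0.4) LOOP MATRICES UNDER THE COVER**: `loopMhZ L (V ∘ π_j) ĉ i = loopMh V (π_{j+1} ĉ) i` (standing range; same loop word, `IdxZ P.d P.L = Idx P` and `offZ = off` by `rfl`).
[cite: Balaban1987RG1, (0.4) p.253, (1.21) p.264] -/
theorem loopMhZ_comp_coverBondAt (hj : j + 1 ≤ P.m + P.K) (V : PBond P j → MatA 2) (ĉ : (Fin P.d → ℤ) × Fin P.d) (i : IdxZ P.d P.L) :
    loopMhZ P.L (fun b => V (coverBondAt P j b)) ĉ i = loopMh V (coverBondAt P (j + 1) ĉ) i := by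
  unfold loopMhZ loopMh
  rw [coverBondAt_src, coverBondAt_dir, emb_coverAt_eq_coverAt_embZ hj, holMh_walk_coverAt]
  rfl

/-- ★ **THE STRAIGHT SEGMENT UNDER THE COVER**: `axialMhZ L (V ∘ π_j) ĉ = axialMh V (π_{j+1} ĉ)` (standing range). [cite: Balaban1987RG1, (0.4) p.253; Balaban1984PropagatorsI, (1.7) p.18] -/
theorem axialMhZ_comp_coverBondAt (hj : j + 1 ≤ P.m + P.K) (V : PBond P j → MatA 2) (ĉ : (Fin P.d → ℤ) × Fin P.d) :
    axialMhZ P.L (fun b => V (coverBondAt P j b)) ĉ = axialMh V (coverBondAt P (j + 1) ĉ) := by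
  unfold axialMhZ axialMh
  rw [coverBondAt_src, coverBondAt_dir, emb_coverAt_eq_coverAt_embZ hj, holMh_walk_coverAt]

/-- **The correction factor under the cover.** [cite: Balaban1987RG1, (0.4) p.253] -/
theorem corrMhZ_comp_coverBondAt (hj : j + 1 ≤ P.m + P.K) (V : PBond P j → MatA 2) (ĉ : (Fin P.d → ℤ) × Fin P.d) :
    corrMhZ P.L (fun b => V (coverBondAt P j b)) ĉ = corrMh V (coverBondAt P (j + 1) ĉ) := by
  unfold corrMhZ corrMh
  congr 1
  funext i
  exact loopMhZ_comp_coverBondAt hj V ĉ i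

/-- ★★ **THE (0.4) AVERAGE UNDER THE COVER**: `avgMhZ L (V ∘ π_j) ĉ = avgMh V (π_{j+1} ĉ)` — for EVERY configuration and EVERY integer coarse bond (standing range `j + 1 ≤ m + K`).
[cite: Balaban1987RG1, (0.4) p.253, (1.21) p.264 («T^{(j+1)} ↗ Z^d»)] -/
theorem avgMhZ_comp_coverBondAt (hj : j + 1 ≤ P.m + P.K) (V : PBond P j → MatA 2) (ĉ : (Fin P.d → ℤ) × Fin P.d) :
    avgMhZ P.L (fun b => V (coverBondAt P j b)) ĉ = avgMh V (coverBondAt P (j + 1) ĉ) := by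
  show corrMhZ P.L _ ĉ * axialMhZ P.L _ ĉ = corrMh V _ * axialMh V _
  rw [corrMhZ_comp_coverBondAt hj, axialMhZ_comp_coverBondAt hj]

/-- ★★ **THE `k`-FOLD ITERATE UNDER THE COVER**: `iterMhZ L k (𝐔 ∘ π_0) = (iterMh k 𝐔) ∘ π_k` for `k ≤ m + K`. [cite: Balaban1987RG1, (0.21) p.256, (1.21) p.264] -/
theorem iterMhZ_comp_coverBondAt : ∀ (k : ℕ), k ≤ P.m + P.K → ∀ U : PBond P 0 → MatA 2,
    iterMhZ P.L k (fun b => U (coverBondAt P 0 b)) = fun b => iterMh k U (coverBondAt P k b)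
  | 0, _, _ => rfl
  | k + 1, hk, U => by
    show avgMhZ P.L (iterMhZ P.L k (fun b => U (coverBondAt P 0 b))) = fun b => avgMh (iterMh k U) (coverBondAt P (k + 1) b)
    rw [iterMhZ_comp_coverBondAt k (Nat.le_of_succ_le hk) U]
    funext ĉ
    exact avgMhZ_comp_coverBondAt hk (iterMh k U) ĉ

end CoverAverages

/-! ## §3  Integer locality of the (0.4) average: every bond of every contour at `ĉ` is a window bond -/

section Window

variable {d : ℕ}

/-- `Function.update z μ (z μ + 1) = z + e_μ` (the `K0RecordFormatNames.intShift` convention is the `B7Prop1Explicit.e` convention). [folklore] -/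
theorem update_add_one_eq_add_e (z : Fin d → ℤ) (μ : Fin d) : Function.update z μ (z μ + 1) = z + e μ := by
  funext ν
  by_cases h : ν = μ
  · subst h; simp [e_apply]
  · simp [h, e_apply]

/-- Walk products read the configuration only on the bonds of the step list. [cite: Balaban1987RG1, (0.4) p.253 (bookkeeping)] -/
theorem holMhZ_congr {V V' : (Fin d → ℤ) × Fin d → MatA 2} {γ : List (((Fin d → ℤ) × Fin d) × Bool)} (h : ∀ s ∈ γ, V s.1 = V' s.1) :
    holMhZ V γ = holMhZ V' γ := by
  unfold holMhZ
  congr 1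
  refine List.map_congr_left fun s hs => ?_
  unfold stepMhZ
  rw [h s hs]

/-- **Both endpoints of every bond of an integer walk are prefix end points** `x + disp (w.take k)`. [folklore] -/
theorem endpoints_of_mem_walkZ : ∀ (x : Fin d → ℤ) (w : List (Letter d)) (s : ((Fin d → ℤ) × Fin d) × Bool), s ∈ walkZ x w →
    (∃ k, s.1.1 = x + disp (w.take k)) ∧ (∃ k, s.1.1 + e s.1.2 = x + disp (w.take k))
  | _, [], s, hs => by simp [walkZ] at hs
  | x, (μ, true) :: w, s, hs => by
    simp only [walkZ, List.mem_cons] at hs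
    rcases hs with rfl | hs
    · exact ⟨⟨0, by simp⟩, ⟨1, by simp⟩⟩
    · obtain ⟨⟨k, hk⟩, ⟨k', hk'⟩⟩ := endpoints_of_mem_walkZ (x + e μ) w s hs
      exact ⟨⟨k + 1, by rw [hk, List.take_succ_cons, disp_cons, Letter.vec_true, add_assoc]⟩,
        ⟨k' + 1, by rw [hk', List.take_succ_cons, disp_cons, Letter.vec_true, add_assoc]⟩⟩
  | x, (μ, false) :: w, s, hs => by
    simp only [walkZ, List.mem_cons] at hs
    rcases hs with rfl | hs
    · exact ⟨⟨1, by simp [sub_eq_add_neg]⟩, ⟨0, by simp⟩⟩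
    · obtain ⟨⟨k, hk⟩, ⟨k', hk'⟩⟩ := endpoints_of_mem_walkZ (x - e μ) w s hs
      exact ⟨⟨k + 1, by rw [hk, List.take_succ_cons, disp_cons, Letter.vec_false, sub_eq_add_neg, add_assoc]⟩,
        ⟨k' + 1, by rw [hk', List.take_succ_cons, disp_cons, Letter.vec_false, sub_eq_add_neg, add_assoc]⟩⟩

/-- **A site near the block centre lies in the window**: `embZ L y + v ∈ B(y) ∪ B(y + e_μ)` whenever `−h ≤ v_ν ≤ h` transversally and `−h ≤ v_μ ≤ L + h` (`L = 2h + 1`).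
[cite: Balaban1987RG1, (0.4) p.253 (the contours stay in the two blocks)] -/
theorem embZ_add_mem_winSitesZ {L : ℕ} (hL : 2 * ((L - 1) / 2) + 1 = L) (y : Fin d → ℤ) (μ : Fin d) (v : Fin d → ℤ)
    (hv : ∀ ν, -(((L - 1) / 2 : ℕ) : ℤ) ≤ v ν ∧ v ν ≤ (if μ = ν then (L : ℤ) else 0) + (((L - 1) / 2 : ℕ) : ℤ)) :
    embZ L y + v ∈ winSitesZ L (y, μ) := by
  set h : ℕ := (L - 1) / 2 with hh
  have hL' : (L : ℤ) = 2 * h + 1 := by exact_mod_cast hL.symm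
  haveI : NeZero L := ⟨by omega⟩
  have hLpos : (0 : ℤ) < L := by exact_mod_cast (show 0 < L by omega)
  unfold winSitesZ
  rw [Finset.mem_union, mem_blockSites_iff, mem_blockSites_iff]
  by_cases hfar : v μ ≤ (h : ℤ)
  · left
    funext ν
    simp only [blockMap, Pi.add_apply, embZ]
    have h1 := (hv ν).1
    have h2 : v ν ≤ h := by
      by_cases hν : μ = ν
      · rw [← hν]; exact hfar
      · have := (hv ν).2; rw [if_neg hν] at this; linarith
    have e1 : (L : ℤ) * y ν + (h : ℤ) + v ν = ((h : ℤ) + v ν) + (L : ℤ) * y ν := by ring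
    rw [← hh, e1, Int.add_mul_ediv_left _ _ hLpos.ne', Int.ediv_eq_zero_of_lt (by omega) (by omega), zero_add]
  · right
    funext ν
    simp only [blockMap, Pi.add_apply, embZ]
    by_cases hν : ν = μ
    · subst hν
      have := (hv ν).2
      rw [if_pos rfl] at this
      have e1 : (L : ℤ) * y ν + (h : ℤ) + v ν = ((h : ℤ) + v ν - L) + (L : ℤ) * (y ν + 1) := by ring
      rw [← hh, e1, Int.add_mul_ediv_left _ _ hLpos.ne', Int.ediv_eq_zero_of_lt (by omega) (by omega), zero_add, e_apply, if_pos rfl]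
    · have h1 := (hv ν).1
      have h2 : v ν ≤ h := by have := (hv ν).2; rw [if_neg (Ne.symm hν)] at this; linarith
      have e1 : (L : ℤ) * y ν + (h : ℤ) + v ν = ((h : ℤ) + v ν) + (L : ℤ) * y ν := by ring
      rw [← hh, e1, Int.add_mul_ediv_left _ _ hLpos.ne', Int.ediv_eq_zero_of_lt (by omega) (by omega), zero_add, e_apply, if_neg hν, add_zero]

/-- Membership in the window bonds. [cite: Balaban1987RG1, (0.4) p.253 (bookkeeping)] -/
theorem mem_winBondsZ_iff {L : ℕ} {ĉ : (Fin d → ℤ) × Fin d} {b : (Fin d → ℤ) × Fin d} :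
    b ∈ winBondsZ L ĉ ↔ b.1 ∈ winSitesZ L ĉ ∧ b.1 + e b.2 ∈ winSitesZ L ĉ := by
  simp [winBondsZ]

/-- ★ **EVERY BOND OF EVERY (0.4) CONTOUR AT `ĉ` IS A WINDOW BOND** (prefix displacements of the loop word stay in the box `[−h, h]^{d−1} × [−h, L + h]`, `netDisp_take_loopWord`).
[cite: Balaban1987RG1, (0.4) p.253] -/
theorem mem_winBondsZ_of_mem_walkZ_loopWord {L : ℕ} (hL : 2 * ((L - 1) / 2) + 1 = L) (ĉ : (Fin d → ℤ) × Fin d) (i : IdxZ d L)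
    {s : ((Fin d → ℤ) × Fin d) × Bool} (hs : s ∈ walkZ (embZ L ĉ.1) (loopWord L ĉ.2 (offZ L i.1) i.2.1 i.2.2)) : s.1 ∈ winBondsZ L ĉ := by
  obtain ⟨⟨k, hk⟩, ⟨k', hk'⟩⟩ := endpoints_of_mem_walkZ _ _ s hs
  have hoff : ∀ κ, -(((L - 1) / 2 : ℕ) : ℤ) ≤ offZ L i.1 κ ∧ offZ L i.1 κ ≤ (((L - 1) / 2 : ℕ) : ℤ) := fun κ =>
    ⟨(offZ_bounds L i.1 κ).1, by have := (offZ_bounds L i.1 κ).2; omega⟩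
  have hb : ∀ (k : ℕ) (ν : Fin d), -(((L - 1) / 2 : ℕ) : ℤ) ≤ disp ((loopWord L ĉ.2 (offZ L i.1) i.2.1 i.2.2).take k) ν ∧
      disp ((loopWord L ĉ.2 (offZ L i.1) i.2.1 i.2.2).take k) ν ≤ (if ĉ.2 = ν then (L : ℤ) else 0) + (((L - 1) / 2 : ℕ) : ℤ) := by
    intro k ν
    rw [disp_eq_netDisp]
    exact netDisp_take_loopWord (L := L) (h := (L - 1) / 2) ĉ.2 (offZ L i.1) hoff i.2.1 i.2.2 k ν
  rw [mem_winBondsZ_iff, hk', hk]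
  exact ⟨embZ_add_mem_winSitesZ hL ĉ.1 ĉ.2 _ (hb k), embZ_add_mem_winSitesZ hL ĉ.1 ĉ.2 _ (hb k')⟩

/-- **Every bond of the straight segment at `ĉ` is a window bond.** [cite: Balaban1984PropagatorsI, (1.7) p.18] -/
theorem mem_winBondsZ_of_mem_walkZ_replicate {L : ℕ} (hL : 2 * ((L - 1) / 2) + 1 = L) (ĉ : (Fin d → ℤ) × Fin d)
    {s : ((Fin d → ℤ) × Fin d) × Bool} (hs : s ∈ walkZ (embZ L ĉ.1) (List.replicate L (ĉ.2, true))) : s.1 ∈ winBondsZ L ĉ := by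
  obtain ⟨⟨k, hk⟩, ⟨k', hk'⟩⟩ := endpoints_of_mem_walkZ _ _ s hs
  have hb : ∀ (k : ℕ) (ν : Fin d), -(((L - 1) / 2 : ℕ) : ℤ) ≤ disp ((List.replicate L ((ĉ.2, true) : Letter d)).take k) ν ∧
      disp ((List.replicate L ((ĉ.2, true) : Letter d)).take k) ν ≤ (if ĉ.2 = ν then (L : ℤ) else 0) + (((L - 1) / 2 : ℕ) : ℤ) := by
    intro k ν
    rw [List.take_replicate, disp_replicate, Letter.vec_true, Pi.smul_apply, e_apply, smul_eq_mul]
    have hmin : (min k L : ℤ) ≤ L := by exact_mod_cast min_le_right k L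
    by_cases hν : ν = ĉ.2
    · subst hν; simp only [if_true, mul_one]; constructor <;> omega
    · rw [if_neg hν, if_neg (Ne.symm hν), mul_zero]; constructor <;> omega
  rw [mem_winBondsZ_iff, hk', hk]
  exact ⟨embZ_add_mem_winSitesZ hL ĉ.1 ĉ.2 _ (hb k), embZ_add_mem_winSitesZ hL ĉ.1 ĉ.2 _ (hb k')⟩

/-- ★ **INTEGER LOCALITY OF THE (0.4) AVERAGE**: `avgMhZ L 𝐕 ĉ` reads `𝐕` only on the window bonds of `ĉ`. [cite: Balaban1987RG1, (0.4) p.253, (1.7) p.261] -/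
theorem avgMhZ_congr_of_eqOn_winBondsZ {L : ℕ} (hL : 2 * ((L - 1) / 2) + 1 = L) {V V' : (Fin d → ℤ) × Fin d → MatA 2} (ĉ : (Fin d → ℤ) × Fin d)
    (h : ∀ b ∈ winBondsZ L ĉ, V b = V' b) : avgMhZ L V ĉ = avgMhZ L V' ĉ := by
  have hl : (fun i : IdxZ d L => loopMhZ L V ĉ i) = fun i => loopMhZ L V' ĉ i :=
    funext fun i => holMhZ_congr fun s hs => h s.1 (mem_winBondsZ_of_mem_walkZ_loopWord hL ĉ i hs)
  have ha : axialMhZ L V ĉ = axialMhZ L V' ĉ := holMhZ_congr fun s hs => h s.1 (mem_winBondsZ_of_mem_walkZ_replicate hL ĉ hs)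
  show corrMhZ L V ĉ * axialMhZ L V ĉ = corrMhZ L V' ĉ * axialMhZ L V' ĉ
  unfold corrMhZ
  rw [hl, ha]

/-- Extension after restriction agrees with the configuration on the bond set. [cite: Balaban1987RG1, (1.7) p.261 (bookkeeping)] -/
theorem extendZ_restrictZ_of_mem {S : Finset ((Fin d → ℤ) × Fin d)} (V : (Fin d → ℤ) × Fin d → MatA 2) {b : (Fin d → ℤ) × Fin d} (hb : b ∈ S) :
    extendZ S (restrictZ S V) b = V b := by
  simp [extendZ, restrictZ, hb]

/-- **The window-restricted average IS the average**: `avgMhZW L ĉ (𝐕|_window) = avgMhZ L 𝐕 ĉ`. [cite: Balaban1987RG1, (0.4) p.253, p.267] -/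
theorem avgMhZW_restrictZ {L : ℕ} (hL : 2 * ((L - 1) / 2) + 1 = L) (ĉ : (Fin d → ℤ) × Fin d) (V : (Fin d → ℤ) × Fin d → MatA 2) :
    avgMhZW L ĉ (restrictZ (winBondsZ L ĉ) V) = avgMhZ L V ĉ :=
  avgMhZ_congr_of_eqOn_winBondsZ hL ĉ fun _ hb => extendZ_restrictZ_of_mem V hb

/-- **The central bond is a window bond.** [cite: Balaban1987RG1, p.267 (bookkeeping)] -/
theorem centralBondZ_mem_winBondsZ {L : ℕ} (hL : 2 * ((L - 1) / 2) + 1 = L) (ĉ : (Fin d → ℤ) × Fin d) : centralBondZ L ĉ ∈ winBondsZ L ĉ := by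
  have hupd : Function.update (embZ L ĉ.1) ĉ.2 (embZ L ĉ.1 ĉ.2 + (((L - 1) / 2 : ℕ) : ℤ)) = embZ L ĉ.1 + (((L - 1) / 2 : ℕ) : ℤ) • e ĉ.2 := by
    funext ν
    by_cases hν : ν = ĉ.2
    · subst hν; simp [e_apply]
    · simp [hν, e_apply]
  rw [mem_winBondsZ_iff]
  show Function.update (embZ L ĉ.1) ĉ.2 (embZ L ĉ.1 ĉ.2 + (((L - 1) / 2 : ℕ) : ℤ)) ∈ winSitesZ L (ĉ.1, ĉ.2) ∧
    Function.update (embZ L ĉ.1) ĉ.2 (embZ L ĉ.1 ĉ.2 + (((L - 1) / 2 : ℕ) : ℤ)) + e ĉ.2 ∈ winSitesZ L (ĉ.1, ĉ.2)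
  rw [hupd, add_assoc, ← add_one_zsmul]
  refine ⟨embZ_add_mem_winSitesZ hL ĉ.1 ĉ.2 _ fun ν => ?_, embZ_add_mem_winSitesZ hL ĉ.1 ĉ.2 _ fun ν => ?_⟩
  · rw [Pi.smul_apply, e_apply, smul_eq_mul]
    by_cases hν : ν = ĉ.2
    · subst hν; simp only [if_true, mul_one]; constructor <;> omega
    · rw [if_neg hν, if_neg (Ne.symm hν), mul_zero]; constructor <;> omega
  · rw [Pi.smul_apply, e_apply, smul_eq_mul]
    by_cases hν : ν = ĉ.2
    · subst hν; simp only [if_true, mul_one]; constructor <;> omega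
    · rw [if_neg hν, if_neg (Ne.symm hν), mul_zero]; constructor <;> omega

/-- ★ **INTEGER LOCALITY OF THE DERIVATIVE BLOCK**: `A₁^ℤ(ĉ)(𝐕)` reads `𝐕` only on the window bonds of `ĉ`. [cite: Balaban1987RG1, p.267, (1.7) p.261] -/
theorem jacBlockZ_congr_of_eqOn_winBondsZ {L : ℕ} (hL : 2 * ((L - 1) / 2) + 1 = L) {V V' : (Fin d → ℤ) × Fin d → MatA 2} (ĉ : (Fin d → ℤ) × Fin d)
    (h : ∀ b ∈ winBondsZ L ĉ, V b = V' b) : jacBlockZ L ĉ V = jacBlockZ L ĉ V' := by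
  have hr : restrictZ (winBondsZ L ĉ) V = restrictZ (winBondsZ L ĉ) V' := funext fun b => h b.1 b.2
  have hβ : V (centralBondZ L ĉ) = V' (centralBondZ L ĉ) := h _ (centralBondZ_mem_winBondsZ hL ĉ)
  unfold jacBlockZ
  rw [hr, hβ, avgMhZ_congr_of_eqOn_winBondsZ hL ĉ h]

/-- The integer Jacobian factor reads the window only. [cite: Balaban1987RG1, p.267, (1.7) p.261] -/
theorem jacFactorZ_congr_of_eqOn_winBondsZ {L : ℕ} (hL : 2 * ((L - 1) / 2) + 1 = L) {V V' : (Fin d → ℤ) × Fin d → MatA 2} (ĉ : (Fin d → ℤ) × Fin d)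
    (h : ∀ b ∈ winBondsZ L ĉ, V b = V' b) : jacFactorZ L ĉ V = jacFactorZ L ĉ V' := by
  unfold jacFactorZ
  rw [jacBlockZ_congr_of_eqOn_winBondsZ hL ĉ h]

end Window


end Summit.QuantumFields.YangMills.Theorems.BalabanUVNodesPortS1

end
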